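import Literature.Probability.LatticeModels.MeanFieldBoundGHS
import Literature.Probability.LatticeModels.CriticalTwoPointLower
import Literature.Probability.LatticeModels.SharpnessDecayProofs
import Mathlib.Analysis.Calculus.Deriv.MeanValue
import Mathlib.Analysis.SpecificLimits.Normed
import HarnessLib

/-!
# The mean-field bound `γ ≥ 1`: `χ(β) ≥ c (β_c - β)⁻¹` for the nearest-neighbour Ising model

Topic `Probability/LatticeModels`; namespaces `Literature.StatMech` (finite-volume calculus on a locally
finite graph) and `Literature.CritIsing` (the nearest-neighbour model on `ℤ^d`).

We prove, sorry-free and from the tree (GKS, Lebowitz' inequality, the Duminil-Copin–Tassion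
sharpness circle of `MeanFieldBound*`, Peierls), the classical facts quoted in Sakai, *Lace
expansion for the Ising model*, CMP 272 (2007), §1.1 — "The susceptibility `χ_p` is known to
diverge as `p ↑ p_c` [a82, ag83]" and "These exponents (if they exist) are known to obey the
mean-field bounds: … `γ ≥ 1`" — for the nearest-neighbour Ising model on `ℤ^d`, `d ≥ 2`, with the
tree's `susceptibility d β = ∑_x ⟨σ₀σ_x⟩^∅_{β,0} ∈ [0, ∞]` and `criticalBeta d = inf{β ≥ 0 : m*(β) > 0}`:

* `susceptibility_unbounded_below_criticalBeta`: `sup_{β < β_c} χ(β) = ∞`;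
* `susceptibility_eq_top_of_criticalBeta_le`: `χ(β) = ∞` for `β ≥ β_c`;
* `susceptibility_meanField_lower_bound`: **`χ(β) ≥ (4d (β_c - β))⁻¹` for `0 ≤ β < β_c`**
  (the mean-field bound `γ ≥ 1`; the printed constant for the sharp Lebowitz inequality would be
  `(2d(β_c - β))⁻¹ = (|J|(β_c-β))⁻¹`, the tree's Lebowitz covariance bound carries a factor `2`);
* `susceptibility_lt_top_of_lt_criticalBeta` (`χ(β) < ∞` below `β_c`, from the tree's exponential
  decay `twoPoint_exponentialDecay_of_lt_criticalBeta_holds` and the summability of `e^{-c‖x‖}`),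
  and the discharge `criticalBeta_eq_sSup_susceptibility_finite_holds` of the named fact
  `criticalBeta_eq_sSup_susceptibility_finite` of `Sharpness.lean` (crit-ising.S08:
  `β_c = sup{β ≥ 0 : χ(β) < ∞}`).

## The argument (Aizenman 1982 / Aizenman–Newman; Glimm–Jaffe 1987, §17; Fernández–Fröhlich–
## Sokal 1992, §14.1), in finite volume

For a finite volume `Λ` with free boundary condition and zero field put
`S_v(β) = ∑_{y ∈ Λ} ⟨σ_vσ_y⟩_{Λ;β}` (`volumeSusceptibility`). Differentiating the Gibbs average in
`β` (`hasDerivAt_isingExpect`, `GriffithsMonotonicity`) gives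
`S_v'(β) = ∑_y ∑_{ab ∈ ℰ_Λ} (⟨σ_aσ_bσ_vσ_y⟩ - ⟨σ_aσ_b⟩⟨σ_vσ_y⟩)`, and Lebowitz' covariance bound
(`gksExpect_cov_spinPair_le`, `LebowitzInequality`: `≤ 2(⟨σ_vσ_a⟩⟨σ_bσ_y⟩ + ⟨σ_vσ_b⟩⟨σ_aσ_y⟩)`)
yields `S_v' ≤ 2 ∑_a ⟨σ_vσ_a⟩ ∑_{b ∼ a} S_b ≤ 2 D (max_b S_b) S_v` on a graph of degree `≤ D`.
Hence the finite maximum `g = max_v S_v` (nondecreasing in `β` by Griffiths) satisfies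
`g(w) - g(u) ≤ 2D (w-u) g(w)²` on every interval `0 ≤ u ≤ w`, and an elementary telescoping over
fine partitions (`inv_sub_inv_le_of_sub_le_mul_sq`, no differentiability of `g` needed) gives
`1/g(β₁) - 1/g(β₂) ≤ 2D (β₂ - β₁)`. On `ℤ^d` (`D = 2d`), `g_L(β₁) ≤ χ(β₁)` by GKS volume
monotonicity and translation covariance, while `S_0^{Λ_L}(β₂) ↑ χ(β₂)`; so
`1/χ(β₁) ≤ 4d(β₂ - β₁) + 1/χ(β₂)` for `β₁ < β₂`, and it remains to know `sup_{β<β_c} χ(β) = ∞`.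
That is the Simon–Lieb / Duminil-Copin–Tassion mechanism: if `χ ≤ M` on `[0, β_c)` then the
finite-volume box sums `∑_{y ∈ Λ_L} ⟨σ₀σ_y⟩_{Λ_L;β_c} ≤ M`, so the shell sums
`∑_{‖x‖=n} ⟨σ₀σ_x⟩_{Λ_n;β_c} → 0`, so Duminil-Copin–Tassion's `φ_{β_c}(Λ_n) < 1` for some `n`,
hence (finite volume, continuity in `β`) `φ_{β'}(Λ_n) < 1` for some `β' > β_c`, hence `m*(β') = 0`
(`spontaneousMagnetization_eq_zero_of_mem_dctIsingSet_ghs`, `MeanFieldBoundGHS`) — contradicting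
`m*(β') > 0` above `β_c` (`spontaneousMagnetization_pos_of_criticalBeta_lt_holds`, Peierls).
No infinite-volume differentiability and no exponential decay is used.

## References

* M. Aizenman, *Geometric analysis of φ⁴ fields and Ising models I, II*, Comm. Math. Phys. 86
  (1982) 1–48 (mean-field bounds; cited as [a82] by Sakai 2007, §1.1).
* M. Aizenman, R. Graham, Nucl. Phys. B 225 (1983) 261–288 ([ag83] of Sakai 2007, §1.1).
* J. Glimm, A. Jaffe, *Quantum Physics*, 2nd ed. (1987), Cor. 4.3.3 and §17 (Lebowitz bound on
  `∂⟨σσ⟩/∂J`).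
* A. Sakai, Comm. Math. Phys. 272 (2007) 283–344, §1.1 (the statements quoted above).
* H. Duminil-Copin, V. Tassion, Comm. Math. Phys. 343 (2016) 725–745, §2.1 (`φ_β(S)`, `β̃_c = β_c`).
* S. Friedli, Y. Velenik, *Statistical Mechanics of Lattice Systems* (CUP 2017), §3.7.4 (`χ`).
-/

noncomputable section

open MeasureTheory Finset Filter Topology
open scoped ENNReal

namespace Literature.Probability.LatticeModels

/-! ## Part A. Finite volume: the Lebowitz bound on `dS_v/dβ` -/

section FiniteVolume

variable {V : Type*} [DecidableEq V] (G : SimpleGraph V) [G.LocallyFinite]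

/-- The four-spin average `⟨σ_vσ_y σ_aσ_b⟩^{bc}_{Λ;β,h}` as an expectation of the spin system
`ν_{Λ;K}` of `GKSInequalities` (companion of `isingTwoPoint_eq_gksExpect`). [cite: FriedliVelenik2017, §3.8.1, p. 141] -/
theorem isingExpect_spinPair_mul_spinPair_eq_gksExpect (Λ : Finset V) (β h : ℝ)
    (bc : BoundaryCondition V) {v y a b : V} (hv : v ∈ Λ) (hy : y ∈ Λ) (ha : a ∈ Λ) (hb : b ∈ Λ) :
    isingExpect G Λ β h bc (fun σ => spinPair v y σ * spinPair a b σ) =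
      gksExpect (isingIdx G Λ) (gksCoupling G Λ β h bc) (isingSupp Λ)
        (fun τ => spinPair ⟨v, hv⟩ ⟨y, hy⟩ τ * spinPair ⟨a, ha⟩ ⟨b, hb⟩ τ) := by
  have hmeas : Measurable fun σ : SpinConfig V => spinPair v y σ * spinPair a b σ :=
    (measurable_spinPair v y).mul (measurable_spinPair a b)
  rw [isingExpect, integral_isingMeasure G Λ β h bc hmeas, gksExpect, gksSum, gksSum,
    isingPartitionFunction]
  congr 1
  · refine Finset.sum_congr rfl fun τ _ => ?_
    rw [isingWeight_eq_gksWeight, spinPair, spinPair, spinAt_glue_of_mem τ bc hv,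
      spinAt_glue_of_mem τ bc hy, spinAt_glue_of_mem τ bc ha, spinAt_glue_of_mem τ bc hb, spinPair,
      spinPair, mul_comm]
  · refine Finset.sum_congr rfl fun τ _ => ?_
    rw [isingWeight_eq_gksWeight, one_mul]

/-- **Lebowitz' bound on the covariance of two pair observables, Ising form** (Glimm–Jaffe 1987,
Cor. 4.3.2–4.3.3; the tree's `gksExpect_cov_spinPair_le`): for the free or `+` boundary
condition, `β, h ≥ 0` and `v, y, a, b ∈ Λ`,
`⟨σ_vσ_y σ_aσ_b⟩ - ⟨σ_vσ_y⟩⟨σ_aσ_b⟩ ≤ 2(⟨σ_vσ_a⟩⟨σ_bσ_y⟩ + ⟨σ_vσ_b⟩⟨σ_aσ_y⟩)`. [cite: GlimmJaffe1987, Cor. 4.3.2 and Cor. 4.3.3] -/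
theorem isingExpect_cov_spinPair_le (Λ : Finset V) {β h : ℝ} (hβ : 0 ≤ β) (hh : 0 ≤ h)
    {bc : BoundaryCondition V} (hbc : bc = .free ∨ bc = .plus) {v y a b : V} (hv : v ∈ Λ)
    (hy : y ∈ Λ) (ha : a ∈ Λ) (hb : b ∈ Λ) :
    isingExpect G Λ β h bc (fun σ => spinPair v y σ * spinPair a b σ) -
        isingTwoPoint G Λ β h bc v y * isingTwoPoint G Λ β h bc a b ≤
      2 * (isingTwoPoint G Λ β h bc v a * isingTwoPoint G Λ β h bc b y +
        isingTwoPoint G Λ β h bc v b * isingTwoPoint G Λ β h bc a y) := by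
  rw [isingExpect_spinPair_mul_spinPair_eq_gksExpect G Λ β h bc hv hy ha hb,
    isingTwoPoint_eq_gksExpect G Λ β h bc hv hy, isingTwoPoint_eq_gksExpect G Λ β h bc ha hb,
    isingTwoPoint_eq_gksExpect G Λ β h bc hv ha, isingTwoPoint_eq_gksExpect G Λ β h bc hb hy,
    isingTwoPoint_eq_gksExpect G Λ β h bc hv hb, isingTwoPoint_eq_gksExpect G Λ β h bc ha hy]
  exact gksExpect_cov_spinPair_le _ _ _ (gksCoupling_nonneg G hβ hh hbc)
    (fun i _ => card_isingSupp_le_two Λ i) _ _ _ _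

/-- The **finite-volume susceptibility seen from `v`**: `S_v(β) = ∑_{y ∈ Λ} ⟨σ_vσ_y⟩^∅_{Λ;β,0}`
(free boundary condition, zero field; the term `y = v` equals `1`). (Friedli–Velenik 2017,
§3.7.4, eq. (3.67), in finite volume.) [cite: FriedliVelenik2017, §3.7.4, eq. (3.67)] -/
def volumeSusceptibility (Λ : Finset V) (β : ℝ) (v : V) : ℝ :=
  ∑ y ∈ Λ, isingTwoPoint G Λ β 0 .free v y

/-- The `β`-derivative of a free, zero-field pair correlation is the sum over the bonds of `Λ` of
the bond–pair covariances: `d/dβ ⟨σ_vσ_y⟩_{Λ;β} = ∑_{e ∈ ℰ_Λ} (⟨σ_e σ_vσ_y⟩ - ⟨σ_e⟩⟨σ_vσ_y⟩)`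
(Friedli–Velenik 2017, Exercise 3.13; Glimm–Jaffe 1987, Prop. 4.2.1). [cite: FriedliVelenik2017, Exercise 3.13] -/
theorem hasDerivAt_isingTwoPoint_free (Λ : Finset V) (β : ℝ) (v y : V) :
    HasDerivAt (fun β => isingTwoPoint G Λ β 0 .free v y)
      (∑ e ∈ edgesIn G Λ, (isingExpect G Λ β 0 .free (fun σ => bondSpin σ e * spinPair v y σ) -
        isingExpect G Λ β 0 .free (fun σ => bondSpin σ e) * isingTwoPoint G Λ β 0 .free v y)) β := by
  have hD := hasDerivAt_isingExpect G Λ 0 .free β (measurable_spinPair v y)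
  have hH := isingExpect_negHamiltonian_mul G Λ 0 .free β (f := fun _ => (1 : ℝ)) measurable_const
  simp only [mul_one] at hH
  refine hD.congr_deriv ?_
  rw [isingExpect_negHamiltonian_mul G Λ 0 .free β (measurable_spinPair v y), hH]
  simp only [interactionEdges_free, zero_mul, add_zero, isingTwoPoint]
  rw [Finset.sum_sub_distrib, Finset.sum_mul]

/-- Each bond–pair covariance is bounded by Lebowitz: for `e = {a,b} ∈ ℰ_Λ`, `β ≥ 0`, `v, y ∈ Λ`,
`⟨σ_eσ_vσ_y⟩ - ⟨σ_e⟩⟨σ_vσ_y⟩ ≤ 2(⟨σ_vσ_a⟩⟨σ_bσ_y⟩ + ⟨σ_vσ_b⟩⟨σ_aσ_y⟩)`. [cite: GlimmJaffe1987, Cor. 4.3.3] -/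
theorem bondCov_le (Λ : Finset V) {β : ℝ} (hβ : 0 ≤ β) {v y : V} (hv : v ∈ Λ) (hy : y ∈ Λ)
    {e : Sym2 V} (he : e ∈ edgesIn G Λ) :
    isingExpect G Λ β 0 .free (fun σ => bondSpin σ e * spinPair v y σ) -
        isingExpect G Λ β 0 .free (fun σ => bondSpin σ e) * isingTwoPoint G Λ β 0 .free v y ≤
      Sym2.lift ⟨fun a b => 2 * (isingTwoPoint G Λ β 0 .free v a * isingTwoPoint G Λ β 0 .free b y +
        isingTwoPoint G Λ β 0 .free v b * isingTwoPoint G Λ β 0 .free a y),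
        fun a b => by ring⟩ e := by
  obtain ⟨-, hmem⟩ := mem_edgesIn_iff.1 he
  induction e using Sym2.ind with
  | _ a b =>
    have ha : a ∈ Λ := hmem a (Sym2.mem_mk_left a b)
    have hb : b ∈ Λ := hmem b (Sym2.mem_mk_right a b)
    rw [Sym2.lift_mk]
    have h1 : (fun σ : SpinConfig V => bondSpin σ s(a, b) * spinPair v y σ) =
        fun σ => spinPair v y σ * spinPair a b σ := by
      funext σ; simp only [bondSpin_mk, spinPair]; ring
    have h2 : (fun σ : SpinConfig V => bondSpin σ s(a, b)) = spinPair a b := by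
      funext σ; simp only [bondSpin_mk, spinPair]
    rw [h1, h2]
    have h3 : isingExpect G Λ β 0 .free (spinPair a b) = isingTwoPoint G Λ β 0 .free a b := rfl
    rw [h3, mul_comm (isingTwoPoint G Λ β 0 .free a b)]
    exact isingExpect_cov_spinPair_le G Λ hβ le_rfl (Or.inl rfl) hv hy ha hb

/-- **Lebowitz' bound on `d⟨σ_vσ_y⟩/dβ`** ("the derivatives are bounded from above by sums of
products of two-point functions", Glimm–Jaffe 1987, §17): for `β ≥ 0` and `v, y ∈ Λ`,
`d/dβ ⟨σ_vσ_y⟩_{Λ;β} ≤ 2 ∑_{a ∈ Λ} ∑_{b ∈ Λ, b ∼ a} ⟨σ_vσ_a⟩_{Λ;β} ⟨σ_bσ_y⟩_{Λ;β}`. [cite: GlimmJaffe1987, Cor. 4.3.3 and §17] -/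
theorem deriv_isingTwoPoint_free_le [DecidableRel G.Adj] (Λ : Finset V) {β : ℝ} (hβ : 0 ≤ β)
    {v y : V} (hv : v ∈ Λ) (hy : y ∈ Λ) :
    deriv (fun β => isingTwoPoint G Λ β 0 .free v y) β ≤
      2 * ∑ a ∈ Λ, ∑ b ∈ Λ.filter (G.Adj a),
        isingTwoPoint G Λ β 0 .free v a * isingTwoPoint G Λ β 0 .free b y := by
  rw [(hasDerivAt_isingTwoPoint_free G Λ β v y).deriv, Finset.mul_sum]
  simp_rw [Finset.mul_sum]
  refine le_of_le_of_eq ?_ (sum_adj_eq_sum_edgesIn (G := G) (Λ := Λ)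
    (fun a b => 2 * (isingTwoPoint G Λ β 0 .free v a * isingTwoPoint G Λ β 0 .free b y))).symm
  refine Finset.sum_le_sum fun e he => (bondCov_le G Λ hβ hv hy he).trans (le_of_eq ?_)
  induction e using Sym2.ind with
  | _ a b => simp only [Sym2.lift_mk]; ring

/-- The finite-volume susceptibility is differentiable in `β`, with derivative the sum of the
derivatives of the pair correlations. [cite: FriedliVelenik2017, Exercise 3.13] -/
theorem hasDerivAt_volumeSusceptibility (Λ : Finset V) (β : ℝ) (v : V) :
    HasDerivAt (fun β => volumeSusceptibility G Λ β v)
      (∑ y ∈ Λ, deriv (fun β => isingTwoPoint G Λ β 0 .free v y) β) β := by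
  unfold volumeSusceptibility
  exact HasDerivAt.fun_sum fun y _ => (hasDerivAt_isingTwoPoint_free G Λ β v y).differentiableAt.hasDerivAt

/-- **The differential inequality `S_v' ≤ 2 D M S_v`**: on a graph all of whose vertices have at
most `D` neighbours, for `β ≥ 0`, `v ∈ Λ`, if the two-point functions of `Λ` are nonnegative and
`S_b(β) ≤ M` for every `b ∈ Λ`, then `dS_v/dβ ≤ 2 D M S_v(β)` (Lebowitz' bound summed over `y`;
the finite-volume form of `dχ/dβ ≤ |J| χ²`, Aizenman 1982; Glimm–Jaffe 1987, §17). [cite: GlimmJaffe1987, Cor. 4.3.3 and §17] -/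
theorem deriv_volumeSusceptibility_le [DecidableRel G.Adj] (Λ : Finset V) {β : ℝ} (hβ : 0 ≤ β)
    {v : V} (hv : v ∈ Λ) {D : ℕ} (hdeg : ∀ a, #(G.neighborFinset a) ≤ D)
    (hnn : ∀ a ∈ Λ, ∀ b ∈ Λ, 0 ≤ isingTwoPoint G Λ β 0 .free a b) {M : ℝ}
    (hM : ∀ b ∈ Λ, volumeSusceptibility G Λ β b ≤ M) :
    deriv (fun β => volumeSusceptibility G Λ β v) β ≤
      2 * D * M * volumeSusceptibility G Λ β v := by
  rw [(hasDerivAt_volumeSusceptibility G Λ β v).deriv]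
  have hM0 : 0 ≤ M := by
    have h := hM v hv
    have h1 : 0 ≤ volumeSusceptibility G Λ β v := Finset.sum_nonneg fun y hy => hnn v hv y hy
    linarith
  -- Lebowitz on each `y`, then exchange the sums
  calc ∑ y ∈ Λ, deriv (fun β => isingTwoPoint G Λ β 0 .free v y) β
      ≤ ∑ y ∈ Λ, 2 * ∑ a ∈ Λ, ∑ b ∈ Λ.filter (G.Adj a),
          isingTwoPoint G Λ β 0 .free v a * isingTwoPoint G Λ β 0 .free b y :=
        Finset.sum_le_sum fun y hy => deriv_isingTwoPoint_free_le G Λ hβ hv hy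
    _ = 2 * ∑ a ∈ Λ, isingTwoPoint G Λ β 0 .free v a *
          ∑ b ∈ Λ.filter (G.Adj a), volumeSusceptibility G Λ β b := by
        rw [← Finset.mul_sum, Finset.sum_comm]
        congr 1
        refine Finset.sum_congr rfl fun a _ => ?_
        rw [Finset.mul_sum, Finset.sum_comm]
        refine Finset.sum_congr rfl fun b _ => ?_
        rw [volumeSusceptibility, Finset.mul_sum]
    _ ≤ 2 * ∑ a ∈ Λ, isingTwoPoint G Λ β 0 .free v a * (D * M) := by
        refine mul_le_mul_of_nonneg_left (Finset.sum_le_sum fun a ha => ?_) (by norm_num)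
        refine mul_le_mul_of_nonneg_left ?_ (hnn v hv a ha)
        calc ∑ b ∈ Λ.filter (G.Adj a), volumeSusceptibility G Λ β b
            ≤ ∑ _b ∈ Λ.filter (G.Adj a), M := Finset.sum_le_sum fun b hb => hM b (Finset.mem_filter.1 hb).1
          _ = #(Λ.filter (G.Adj a)) * M := by rw [Finset.sum_const, nsmul_eq_mul]
          _ ≤ D * M := by
              refine mul_le_mul_of_nonneg_right ?_ hM0
              have h1 : #(Λ.filter (G.Adj a)) ≤ #(G.neighborFinset a) :=
                Finset.card_le_card fun b hb => by
                  rw [SimpleGraph.mem_neighborFinset]; exact (Finset.mem_filter.1 hb).2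
              exact_mod_cast h1.trans (hdeg a)
    _ = 2 * D * M * volumeSusceptibility G Λ β v := by
        rw [← Finset.sum_mul, volumeSusceptibility]; ring

end FiniteVolume

/-! ## Part B. The telescoping lemma: `g(w) - g(u) ≤ K (w-u) g(w)²` forces `1/g(s) - 1/g(t) ≤ K(t-s)` -/

/-- **Discrete Riccati comparison.** Let `g` be nondecreasing on `[s, t]` with `g(s) > 0`, and
suppose `g(w) - g(u) ≤ K (w - u) g(w)²` whenever `s ≤ u ≤ w ≤ t` (`K ≥ 0`). Then
`g(s)⁻¹ - g(t)⁻¹ ≤ K (t - s)`. (Over the uniform partition of mesh `δ = (t-s)/n`: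
`1/g(tᵢ) - 1/g(tᵢ₊₁) ≤ K δ g(tᵢ₊₁)/g(tᵢ) ≤ K δ (1 + (g(tᵢ₊₁) - g(tᵢ))/g(s))`, which telescopes to
`K(t-s) + Kδ (g(t)-g(s))/g(s)`; let `n → ∞`. This is the integrated form of `(1/χ)' ≥ -K` used for
the mean-field bound `γ ≥ 1`, Aizenman 1982; Glimm–Jaffe 1987, §17.) [folklore] -/
theorem inv_sub_inv_le_of_sub_le_mul_sq {g : ℝ → ℝ} {s t K : ℝ} (hst : s ≤ t) (hK : 0 ≤ K)
    (hpos : 0 < g s) (hmono : MonotoneOn g (Set.Icc s t))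
    (hstep : ∀ u w, s ≤ u → u ≤ w → w ≤ t → g w - g u ≤ K * (w - u) * g w ^ 2) :
    (g s)⁻¹ - (g t)⁻¹ ≤ K * (t - s) := by
  -- positivity on `[s, t]`
  have hgpos : ∀ u, s ≤ u → u ≤ t → 0 < g u := fun u hsu hut =>
    hpos.trans_le (hmono ⟨le_rfl, hst⟩ ⟨hsu, hut⟩ hsu)
  -- the bound for every `n ≥ 1`
  have key : ∀ n : ℕ, 0 < n →
      (g s)⁻¹ - (g t)⁻¹ ≤ K * (t - s) + K * ((t - s) / n) * ((g t - g s) / g s) := by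
    intro n hn
    set δ : ℝ := (t - s) / n with hδ
    have hδ0 : 0 ≤ δ := div_nonneg (sub_nonneg.2 hst) n.cast_nonneg
    set p : ℕ → ℝ := fun i => s + i * δ with hp
    have hp0 : p 0 = s := by simp [hp]
    have hpn : p n = t := by
      simp only [hp, hδ]
      field_simp
      ring
    have hp_mono : ∀ i j : ℕ, i ≤ j → p i ≤ p j := fun i j hij => by
      simp only [hp]
      have : (i : ℝ) ≤ j := by exact_mod_cast hij
      nlinarith
    have hps : ∀ i : ℕ, s ≤ p i := fun i => by simpa [hp0] using hp_mono 0 i (Nat.zero_le i)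
    have hpt : ∀ i : ℕ, i ≤ n → p i ≤ t := fun i hi => by simpa [hpn] using hp_mono i n hi
    have hsucc : ∀ i : ℕ, p (i + 1) - p i = δ := fun i => by simp only [hp]; push_cast; ring
    -- one step
    have step : ∀ i : ℕ, i + 1 ≤ n →
        (g (p i))⁻¹ - (g (p (i + 1)))⁻¹ ≤ K * δ + K * δ * ((g (p (i + 1)) - g (p i)) / g s) := by
      intro i hi
      have hi' : i ≤ n := (Nat.le_succ i).trans hi
      have hgi : 0 < g (p i) := hgpos _ (hps i) (hpt i hi')
      have hgi1 : 0 < g (p (i + 1)) := hgpos _ (hps (i + 1)) (hpt (i + 1) hi)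
      have hle : p i ≤ p (i + 1) := hp_mono i (i + 1) (Nat.le_succ i)
      have hinc : g (p i) ≤ g (p (i + 1)) :=
        hmono ⟨hps i, hpt i hi'⟩ ⟨hps (i + 1), hpt (i + 1) hi⟩ hle
      have hst' := hstep (p i) (p (i + 1)) (hps i) hle (hpt (i + 1) hi)
      rw [hsucc] at hst'
      -- `1/gᵢ - 1/gᵢ₊₁ = (gᵢ₊₁ - gᵢ)/(gᵢ gᵢ₊₁) ≤ K δ gᵢ₊₁ / gᵢ`
      have h1 : (g (p i))⁻¹ - (g (p (i + 1)))⁻¹ ≤ K * δ * (g (p (i + 1)) / g (p i)) := by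
        rw [inv_sub_inv hgi.ne' hgi1.ne', div_le_iff₀ (mul_pos hgi hgi1)]
        calc g (p (i + 1)) - g (p i) ≤ K * δ * g (p (i + 1)) ^ 2 := hst'
          _ = K * δ * (g (p (i + 1)) / g (p i)) * (g (p i) * g (p (i + 1))) := by
              field_simp
      -- `gᵢ₊₁/gᵢ = 1 + (gᵢ₊₁ - gᵢ)/gᵢ ≤ 1 + (gᵢ₊₁ - gᵢ)/g(s)`
      have h2 : g (p (i + 1)) / g (p i) ≤ 1 + (g (p (i + 1)) - g (p i)) / g s := by
        have hgs : g s ≤ g (p i) := hmono ⟨le_rfl, hst⟩ ⟨hps i, hpt i hi'⟩ (hps i)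
        rw [show g (p (i + 1)) / g (p i) = 1 + (g (p (i + 1)) - g (p i)) / g (p i) by
          field_simp; ring]
        have hnum : 0 ≤ g (p (i + 1)) - g (p i) := sub_nonneg.2 hinc
        have := div_le_div_of_nonneg_left hnum hpos hgs
        linarith
      calc (g (p i))⁻¹ - (g (p (i + 1)))⁻¹ ≤ K * δ * (g (p (i + 1)) / g (p i)) := h1
        _ ≤ K * δ * (1 + (g (p (i + 1)) - g (p i)) / g s) :=
            mul_le_mul_of_nonneg_left h2 (mul_nonneg hK hδ0)
        _ = K * δ + K * δ * ((g (p (i + 1)) - g (p i)) / g s) := by ring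
    -- telescope over `i < n`
    have tele : ∀ m : ℕ, m ≤ n →
        (g (p 0))⁻¹ - (g (p m))⁻¹ ≤ K * δ * m + K * δ * ((g (p m) - g (p 0)) / g s) := by
      intro m hm
      induction m with
      | zero => simp
      | succ m ih =>
        have ih' := ih ((Nat.le_succ m).trans hm)
        have hs' := step m hm
        have hsplit : (g (p 0))⁻¹ - (g (p (m + 1)))⁻¹ =
            ((g (p 0))⁻¹ - (g (p m))⁻¹) + ((g (p m))⁻¹ - (g (p (m + 1)))⁻¹) := by ring
        rw [hsplit]
        have hdiv : (g (p (m + 1)) - g (p 0)) / g s =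
            (g (p m) - g (p 0)) / g s + (g (p (m + 1)) - g (p m)) / g s := by
          rw [← add_div]; ring_nf
        rw [hdiv]
        push_cast
        nlinarith [ih', hs']
    have := tele n le_rfl
    rw [hp0, hpn] at this
    calc (g s)⁻¹ - (g t)⁻¹ ≤ K * δ * n + K * δ * ((g t - g s) / g s) := this
      _ = K * (t - s) + K * ((t - s) / n) * ((g t - g s) / g s) := by
          simp only [hδ]
          have hn' : (n : ℝ) ≠ 0 := by exact_mod_cast hn.ne'
          field_simp
  -- let `n → ∞`
  have hlim : Tendsto (fun n : ℕ => K * (t - s) + K * ((t - s) / n) * ((g t - g s) / g s))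
      atTop (𝓝 (K * (t - s) + K * 0 * ((g t - g s) / g s))) := by
    refine tendsto_const_nhds.add ((tendsto_const_nhds.mul ?_).mul tendsto_const_nhds)
    exact tendsto_const_nhds.div_atTop tendsto_natCast_atTop_atTop
  rw [mul_zero, zero_mul, add_zero] at hlim
  exact ge_of_tendsto hlim (eventually_atTop.2 ⟨1, fun n hn => key n hn⟩)

/-- **The comparison for a finite maximum of smooth functions.** Let `f i`, `i ∈ I` (finite,
nonempty), be functions differentiable on `ℝ`, nondecreasing and nonnegative on `[0, ∞)`, and let
`g(β) = max_{i ∈ I} f i β`. Assume `0 ≤ s ≤ t`, `g(s) > 0`, and the differential inequality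
`(f i)'(β) ≤ K g(β) f i β` for all `β ≥ 0` and `i ∈ I` (`K ≥ 0`). Then `g(s)⁻¹ - g(t)⁻¹ ≤ K (t - s)`.
(Mean value inequality on each `f i` over `[u, w]` with the constant bound `K g(w)²`, evaluated at
the index attaining the maximum at `w`, then `inv_sub_inv_le_of_sub_le_mul_sq`.) [folklore] -/
theorem inv_sup_sub_inv_sup_le {ι : Type*} (I : Finset ι) (hI : I.Nonempty) (f : ι → ℝ → ℝ)
    {K s t : ℝ} (hK : 0 ≤ K) (hs : 0 ≤ s) (hst : s ≤ t)
    (hdiff : ∀ i ∈ I, Differentiable ℝ (f i))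
    (hmono : ∀ i ∈ I, MonotoneOn (f i) (Set.Ici 0))
    (hnn : ∀ i ∈ I, ∀ β, 0 ≤ β → 0 ≤ f i β)
    (hpos : 0 < I.sup' hI (fun i => f i s))
    (hderiv : ∀ i ∈ I, ∀ β, 0 ≤ β → deriv (f i) β ≤ K * I.sup' hI (fun j => f j β) * f i β) :
    (I.sup' hI (fun i => f i s))⁻¹ - (I.sup' hI (fun i => f i t))⁻¹ ≤ K * (t - s) := by
  set g : ℝ → ℝ := fun β => I.sup' hI (fun i => f i β) with hg
  have hfg : ∀ i ∈ I, ∀ β, f i β ≤ g β := fun i hi β => Finset.le_sup' (fun i => f i β) hi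
  have hgmono : MonotoneOn g (Set.Ici 0) := by
    intro u hu w hw huw
    obtain ⟨i, hi, hgi⟩ := Finset.exists_mem_eq_sup' hI (fun i => f i u)
    change g u = f i u at hgi
    rw [hgi]
    exact (hmono i hi hu hw huw).trans (hfg i hi w)
  have hgnn : ∀ β, 0 ≤ β → 0 ≤ g β := fun β hβ => by
    obtain ⟨i, hi⟩ := hI
    exact (hnn i hi β hβ).trans (hfg i hi β)
  change (g s)⁻¹ - (g t)⁻¹ ≤ K * (t - s)
  refine inv_sub_inv_le_of_sub_le_mul_sq hst hK hpos (hgmono.mono fun u hu => hs.trans hu.1) ?_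
  intro u w hsu huw hwt
  have hu0 : 0 ≤ u := hs.trans hsu
  have hw0 : 0 ≤ w := hu0.trans huw
  -- the maximum at `w` is attained at some `i`
  obtain ⟨i, hi, hgi⟩ := Finset.exists_mem_eq_sup' hI (fun i => f i w)
  change g w = f i w at hgi
  have hgu : f i u ≤ g u := hfg i hi u
  -- mean value inequality for `f i` on `[u, w]` with the constant bound `K g(w) g(w)`
  have hmv : f i w - f i u ≤ K * g w * g w * (w - u) := by
    refine (convex_Icc u w).image_sub_le_mul_sub_of_deriv_le (hdiff i hi).continuous.continuousOn
      ((hdiff i hi).differentiableOn) (fun x hx => ?_) u ⟨le_rfl, huw⟩ w ⟨huw, le_rfl⟩ huw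
    rw [interior_Icc] at hx
    have hx0 : 0 ≤ x := hu0.trans hx.1.le
    calc deriv (f i) x ≤ K * g x * f i x := hderiv i hi x hx0
      _ ≤ K * g w * g w := by
          have h1 : g x ≤ g w := hgmono hx0 hw0 hx.2.le
          have h2 : f i x ≤ g w := (hfg i hi x).trans h1
          have h3 : 0 ≤ f i x := hnn i hi x hx0
          have h4 : 0 ≤ g x := hgnn x hx0
          exact mul_le_mul (mul_le_mul_of_nonneg_left h1 hK) h2 h3
            (mul_nonneg hK (h4.trans h1))
  calc g w - g u ≤ f i w - f i u := by rw [hgi]; linarith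
    _ ≤ K * g w * g w * (w - u) := hmv
    _ = K * (w - u) * g w ^ 2 := by ring

end Literature.Probability.LatticeModels

/-! ## Part C. The nearest-neighbour model on `ℤ^d` -/

namespace Literature.Probability.LatticeModels

open Percolation

variable {d : ℕ}

/-- A box is the disjoint union of the spheres `‖x‖_∞ = n`, `n ≤ L`: sums over `Λ_L` split
into shell sums. [folklore] -/
theorem sum_box_eq_sum_range_sum_sphere (L : ℕ) (f : Site d → ℝ) :
    ∑ x ∈ box d L, f x = ∑ n ∈ Finset.range (L + 1), ∑ x ∈ sphere d n, f x := by
  rw [← Finset.sum_fiberwise_of_maps_to (s := box d L) (t := Finset.range (L + 1))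
    (g := Site.supNorm) (f := f) fun x hx =>
      Finset.mem_range.2 (Nat.lt_succ_of_le (mem_box_iff_supNorm_le.1 hx))]
  refine Finset.sum_congr rfl fun n hn => ?_
  have hfib : (box d L).filter (fun x => Site.supNorm x = n) = sphere d n := by
    ext x
    simp only [Finset.mem_filter, mem_box_iff_supNorm_le, mem_sphere]
    have hn' : n ≤ L := Nat.le_of_lt_succ (Finset.mem_range.1 hn)
    constructor
    · exact fun h => h.2
    · intro h; exact ⟨h ▸ hn', h⟩
  rw [hfib]

section Box

/-! ### The finite-volume susceptibilities of a box -/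

/-- `⟨σ_xσ_y⟩^∅_{Λ;β,0} ≥ 0` on `ℤ^d` for `β ≥ 0`, `x, y ∈ Λ` (GKS I, tree theorem). [cite: FriedliVelenik2017, Thm. 3.20] -/
theorem isingTwoPoint_free_nonneg' {β : ℝ} (hβ : 0 ≤ β) {Λ : Finset (Site d)} {x y : Site d}
    (hx : x ∈ Λ) (hy : y ∈ Λ) : 0 ≤ isingTwoPoint (zdGraph d) Λ β 0 .free x y :=
  isingTwoPoint_free_nonneg (fun {_ _ _ _ _} => Literature.Probability.LatticeModels.GKSInequalities.gks_one_holds (zdGraph d)) hβ hx hy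

/-- `S_v(β) ≥ 1` for `v ∈ Λ`, `β ≥ 0` (the diagonal term is `1`, the others are `≥ 0` by GKS I). [cite: FriedliVelenik2017, Thm. 3.20 and §3.7.4] -/
theorem one_le_volumeSusceptibility {β : ℝ} (hβ : 0 ≤ β) {Λ : Finset (Site d)} {v : Site d}
    (hv : v ∈ Λ) : 1 ≤ volumeSusceptibility (zdGraph d) Λ β v := by
  unfold volumeSusceptibility
  rw [← Finset.add_sum_erase _ _ hv, isingTwoPoint_self]
  have : 0 ≤ ∑ y ∈ Λ.erase v, isingTwoPoint (zdGraph d) Λ β 0 .free v y :=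
    Finset.sum_nonneg fun y hy => isingTwoPoint_free_nonneg' hβ hv (Finset.mem_of_mem_erase hy)
  linarith

/-- `β ↦ S_v(β)` is nondecreasing on `[0, ∞)` (Griffiths' monotonicity in `β`, tree theorem
`isingCorr_free_mono_beta_holds`). [cite: FriedliVelenik2017, Exercise 3.9 with Thm. 3.20] -/
theorem monotoneOn_volumeSusceptibility {Λ : Finset (Site d)} {v : Site d} (hv : v ∈ Λ) :
    MonotoneOn (fun β => volumeSusceptibility (zdGraph d) Λ β v) (Set.Ici 0) := by
  intro β hβ β' _ hββ'
  exact Finset.sum_le_sum fun y hy =>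
    isingTwoPoint_free_mono_beta isingCorr_free_mono_beta_holds hβ hββ' hv hy

/-- **`1/g_Λ(β₁) - 1/g_Λ(β₂) ≤ 4d (β₂ - β₁)`** for the maximal finite-volume susceptibility
`g_Λ(β) = max_{v ∈ Λ} S_v(β)` of a finite volume `Λ ∋ 0` of `ℤ^d` with free boundary condition,
`0 ≤ β₁ ≤ β₂` (the finite-volume integrated form of Lebowitz' `dχ/dβ ≤ 2|J|χ²`; Glimm–Jaffe 1987,
§17; Aizenman 1982). [cite: GlimmJaffe1987, Cor. 4.3.3 and §17] -/
theorem inv_supSusc_sub_inv_supSusc_le (Λ : Finset (Site d)) (h0 : (0 : Site d) ∈ Λ) {β₁ β₂ : ℝ}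
    (hβ₁ : 0 ≤ β₁) (h12 : β₁ ≤ β₂) :
    (Λ.sup' ⟨0, h0⟩ (fun v => volumeSusceptibility (zdGraph d) Λ β₁ v))⁻¹ -
        (Λ.sup' ⟨0, h0⟩ (fun v => volumeSusceptibility (zdGraph d) Λ β₂ v))⁻¹ ≤
      4 * d * (β₂ - β₁) := by
  classical
  have hne : Λ.Nonempty := ⟨0, h0⟩
  have key := inv_sup_sub_inv_sup_le Λ hne (fun v β => volumeSusceptibility (zdGraph d) Λ β v)
    (K := 2 * (2 * d)) (by positivity) hβ₁ h12
    (fun v _ β => (hasDerivAt_volumeSusceptibility (zdGraph d) Λ β v).differentiableAt)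
    (fun v hv => monotoneOn_volumeSusceptibility hv)
    (fun v hv β hβ => zero_le_one.trans (one_le_volumeSusceptibility hβ hv))
    (lt_of_lt_of_le zero_lt_one
      ((one_le_volumeSusceptibility hβ₁ h0).trans (Finset.le_sup' (fun v => _) h0)))
    (fun v hv β hβ => ?_)
  · calc _ ≤ 2 * (2 * d) * (β₂ - β₁) := key
      _ = 4 * d * (β₂ - β₁) := by ring
  · have h := deriv_volumeSusceptibility_le (zdGraph d) Λ hβ hv (D := 2 * d)
      card_neighborFinset_zdGraph_le (fun a ha b hb => isingTwoPoint_free_nonneg' hβ ha hb)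
      (M := Λ.sup' hne (fun b => volumeSusceptibility (zdGraph d) Λ β b))
      (fun b hb => Finset.le_sup' (fun b => volumeSusceptibility (zdGraph d) Λ β b) hb)
    calc deriv (fun β => volumeSusceptibility (zdGraph d) Λ β v) β
        ≤ 2 * ((2 * d : ℕ) : ℝ) * Λ.sup' hne (fun b => volumeSusceptibility (zdGraph d) Λ β b) *
            volumeSusceptibility (zdGraph d) Λ β v := h
      _ = 2 * (2 * d) * Λ.sup' hne (fun b => volumeSusceptibility (zdGraph d) Λ β b) *
            volumeSusceptibility (zdGraph d) Λ β v := by push_cast; ring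

/-- **`S_v^{Λ}(β) ≤ χ(β)`** for `v ∈ Λ`, `β ≥ 0`: by translation covariance and GKS volume
monotonicity `⟨σ_vσ_y⟩^∅_Λ ≤ ⟨σ₀σ_{y-v}⟩^∅_β`, and `y ↦ y - v` is injective (Friedli–Velenik
2017, Exercise 3.12 and proof of Thm. 3.17). [cite: FriedliVelenik2017, Exercise 3.12] -/
theorem ofReal_volumeSusceptibility_le_susceptibility {β : ℝ} (hβ : 0 ≤ β) {Λ : Finset (Site d)}
    {v : Site d} (hv : v ∈ Λ) :
    ENNReal.ofReal (volumeSusceptibility (zdGraph d) Λ β v) ≤ susceptibility d β := by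
  have hlim : hasBoxLimit_isingCorr_free d := hasBoxLimit_isingCorr_free_holds
  have hgks : ∀ {Λ A : Finset (Site d)} {β h : ℝ} {bc : BoundaryCondition (Site d)},
      gks_one (zdGraph d) (Λ := Λ) (A := A) (β := β) (h := h) (bc := bc) :=
    Literature.Probability.LatticeModels.GKSInequalities.gks_one_holds (zdGraph d)
  have hG0 : ∀ y, 0 ≤ twoPointFree d β y := fun y => twoPointFree_nonneg hlim hgks hβ y
  have h1 : volumeSusceptibility (zdGraph d) Λ β v ≤ ∑ y ∈ Λ, twoPointFree d β (y - v) :=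
    Finset.sum_le_sum fun y hy => isingTwoPoint_free_le_twoPointFree_sub
      isingCorr_free_mono_volume_holds hlim isingTwoPoint_free_translate_holds hβ hv hy
  calc ENNReal.ofReal (volumeSusceptibility (zdGraph d) Λ β v)
      ≤ ENNReal.ofReal (∑ y ∈ Λ, twoPointFree d β (y - v)) := ENNReal.ofReal_le_ofReal h1
    _ = ∑ y ∈ Λ, ENNReal.ofReal (twoPointFree d β (y - v)) :=
        ENNReal.ofReal_sum_of_nonneg fun y _ => hG0 _
    _ ≤ ∑' y : Site d, ENNReal.ofReal (twoPointFree d β (y - v)) := ENNReal.sum_le_tsum _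
    _ = ∑' y : Site d, ENNReal.ofReal (twoPointFree d β y) :=
        (Equiv.subRight v).tsum_eq (fun y => ENNReal.ofReal (twoPointFree d β y))
    _ = susceptibility d β := rfl

/-- The susceptibility is the supremum of its box partial sums:
`χ(β) = sup_L ∑_{y ∈ Λ_L} ⟨σ₀σ_y⟩^∅_β` (nonnegative terms). [cite: FriedliVelenik2017, §3.7.4, eq. (3.67)] -/
theorem susceptibility_eq_iSup_box_sum (β : ℝ) :
    susceptibility d β = ⨆ L : ℕ, ∑ y ∈ box d L, ENNReal.ofReal (twoPointFree d β y) :=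
  ENNReal.tsum_eq_iSup_sum' (box d) fun t => (eventually_subset_box' t).exists

/-- **`S_0^{Λ_L}(β) ↑ χ(β)`**: every level below `χ(β)` is exceeded by the finite-volume
susceptibility of all large boxes (monotone convergence of the finite-volume two-point functions
to the free state, Friedli–Velenik 2017, Exercise 3.16, and GKS I). [cite: FriedliVelenik2017, Exercise 3.16] -/
theorem eventually_lt_volumeSusceptibility_box {β : ℝ} (hβ : 0 ≤ β) {r : ℝ≥0∞}
    (hr : r < susceptibility d β) :
    ∀ᶠ L : ℕ in atTop, r < ENNReal.ofReal (volumeSusceptibility (zdGraph d) (box d L) β 0) := by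
  have hlim : hasBoxLimit_isingCorr_free d := hasBoxLimit_isingCorr_free_holds
  have hgks : ∀ {Λ A : Finset (Site d)} {β h : ℝ} {bc : BoundaryCondition (Site d)},
      gks_one (zdGraph d) (Λ := Λ) (A := A) (β := β) (h := h) (bc := bc) :=
    Literature.Probability.LatticeModels.GKSInequalities.gks_one_holds (zdGraph d)
  have hG0 : ∀ y, 0 ≤ twoPointFree d β y := fun y => twoPointFree_nonneg hlim hgks hβ y
  rw [susceptibility_eq_iSup_box_sum, lt_iSup_iff] at hr
  obtain ⟨L₁, hL₁⟩ := hr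
  rw [← ENNReal.ofReal_sum_of_nonneg fun y _ => hG0 y] at hL₁
  set A : ℝ := ∑ y ∈ box d L₁, twoPointFree d β y with hA
  have hrtop : r ≠ ⊤ := ne_top_of_lt hL₁
  have hra : r.toReal < A := by
    have h := hL₁
    rw [← ENNReal.ofReal_toReal hrtop, ENNReal.ofReal_lt_ofReal_iff'] at h
    exact h.1
  -- the finite-volume partial sums over `Λ_{L₁}` converge to `A`
  have hconv : Tendsto (fun L : ℕ => ∑ y ∈ box d L₁, isingTwoPoint (zdGraph d) (box d L) β 0 .free 0 y)
      atTop (𝓝 A) :=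
    tendsto_finsetSum _ fun y _ => tendsto_isingTwoPoint_free hlim hβ y
  have hev : ∀ᶠ L : ℕ in atTop,
      r.toReal < ∑ y ∈ box d L₁, isingTwoPoint (zdGraph d) (box d L) β 0 .free 0 y :=
    hconv.eventually_const_lt hra
  filter_upwards [hev, eventually_ge_atTop L₁] with L hL hLL
  have hsub : box d L₁ ⊆ box d L := box_mono d hLL
  have hle : ∑ y ∈ box d L₁, isingTwoPoint (zdGraph d) (box d L) β 0 .free 0 y ≤
      volumeSusceptibility (zdGraph d) (box d L) β 0 :=
    Finset.sum_le_sum_of_subset_of_nonneg hsub fun y hy _ =>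
      isingTwoPoint_free_nonneg' hβ (zero_mem_box d L) hy
  calc r = ENNReal.ofReal r.toReal := (ENNReal.ofReal_toReal hrtop).symm
    _ < ENNReal.ofReal (volumeSusceptibility (zdGraph d) (box d L) β 0) := by
        rw [ENNReal.ofReal_lt_ofReal_iff']
        refine ⟨hL.trans_le hle, ?_⟩
        exact ENNReal.toReal_nonneg.trans_lt (hL.trans_le hle)

/-- Box partial sums of the susceptibility are bounded by it:
`∑_{y ∈ Λ_L} ⟨σ₀σ_y⟩^∅_{Λ_L;β} ≤ χ(β)` (`≤ ⟨σ₀σ_y⟩^∅_β` termwise by GKS volume monotonicity). [cite: FriedliVelenik2017, Exercise 3.12] -/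
theorem volumeSusceptibility_box_le_of_susceptibility_le {β M : ℝ} (hβ : 0 ≤ β) (hM : 0 ≤ M)
    (hχ : susceptibility d β ≤ ENNReal.ofReal M) (L : ℕ) :
    volumeSusceptibility (zdGraph d) (box d L) β 0 ≤ M := by
  have h := (ofReal_volumeSusceptibility_le_susceptibility (d := d) hβ (zero_mem_box d L)).trans hχ
  exact (ENNReal.ofReal_le_ofReal_iff hM).1 h

end Box

/-! ### Divergence of the susceptibility at `β_c` -/

/-- Continuity in `β` of the finite-volume susceptibility of a box. [folklore] -/
theorem continuous_volumeSusceptibility (Λ : Finset (Site d)) (v : Site d) :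
    Continuous fun β => volumeSusceptibility (zdGraph d) Λ β v :=
  continuous_finsetSum _ fun y _ => continuous_isingExpect (zdGraph d) Λ 0 .free (measurable_spinPair v y)

/-- Continuity in `β` of Duminil-Copin–Tassion's finite-volume functional `φ_β(S)`. [cite: DuminilCopinTassionCMP2016, §2.1, eq. (2.1)] -/
theorem continuous_dctIsingPhi (S : Finset (Site d)) : Continuous fun β => dctIsingPhi d β S := by
  simp only [dctIsingPhi_eq_sum_card_mul]
  have htanh : Continuous Real.tanh := by
    have h : Real.tanh = fun x => Real.sinh x / Real.cosh x := funext Real.tanh_eq_sinh_div_cosh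
    rw [h]
    exact Real.continuous_sinh.div Real.continuous_cosh fun x => (Real.cosh_pos x).ne'
  refine continuous_finsetSum _ fun x _ => continuous_const.mul ?_
  exact htanh.mul (continuous_isingExpect (zdGraph d) S 0 .free (measurable_spinPair 0 x))

/-- `φ_β(Λ_n) ≤ 2d · tanh β · ∑_{‖x‖_∞ = n} ⟨σ₀σ_x⟩^∅_{Λ_n;β}` for `β ≥ 0`: only sites on the
sphere have neighbours outside the box, at most `2d` of them. [cite: DuminilCopinTassionCMP2016, §2.1, eq. (2.1)] -/
theorem dctIsingPhi_box_le {β : ℝ} (hβ : 0 ≤ β) (n : ℕ) :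
    dctIsingPhi d β (box d n) ≤
      2 * d * Real.tanh β * ∑ x ∈ sphere d n, isingTwoPoint (zdGraph d) (box d n) β 0 .free 0 x := by
  rw [dctIsingPhi_eq_sum_card_mul]
  have hvanish : ∀ x ∈ box d n, x ∉ sphere d n →
      (#(((zdGraph d).neighborFinset x).filter (fun y => y ∉ box d n)) : ℝ) *
        (Real.tanh β * isingTwoPoint (zdGraph d) (box d n) β 0 .free 0 x) = 0 := by
    intro x hx hxs
    have hempty : ((zdGraph d).neighborFinset x).filter (fun y => y ∉ box d n) = ∅ := by
      rw [Finset.filter_eq_empty_iff]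
      intro y hy hyn
      rw [SimpleGraph.mem_neighborFinset] at hy
      exact hxs (mem_sphere.2 (supNorm_eq_of_mem_box_of_adj_not_mem hx hyn hy))
    rw [hempty, Finset.card_empty, Nat.cast_zero, zero_mul]
  rw [← Finset.sum_subset (sphere_subset_box d n) hvanish, Finset.mul_sum]
  refine Finset.sum_le_sum fun x hx => ?_
  have hx' : x ∈ box d n := sphere_subset_box d n hx
  have ht : 0 ≤ Real.tanh β * isingTwoPoint (zdGraph d) (box d n) β 0 .free 0 x :=
    mul_nonneg (tanh_nonneg hβ) (isingTwoPoint_free_nonneg' hβ (zero_mem_box d n) hx')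
  have hcard : (#(((zdGraph d).neighborFinset x).filter (fun y => y ∉ box d n)) : ℝ) ≤ 2 * d := by
    have h1 : #(((zdGraph d).neighborFinset x).filter (fun y => y ∉ box d n)) ≤ 2 * d :=
      (Finset.card_filter_le _ _).trans (card_neighborFinset_zdGraph_le x)
    exact_mod_cast h1
  calc _ ≤ (2 * d : ℝ) * (Real.tanh β * isingTwoPoint (zdGraph d) (box d n) β 0 .free 0 x) :=
        mul_le_mul_of_nonneg_right hcard ht
    _ = 2 * d * Real.tanh β * isingTwoPoint (zdGraph d) (box d n) β 0 .free 0 x := by ring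

/-- **If the box sums at `β` are bounded, then `φ_β(Λ_n) < 1` for some `n ≥ 1`.** If
`∑_{y ∈ Λ_L} ⟨σ₀σ_y⟩^∅_{Λ_L;β} ≤ M` for every `L` (`β ≥ 0`), the shell sums
`a_n = ∑_{‖x‖=n} ⟨σ₀σ_x⟩^∅_{Λ_n;β}` have bounded partial sums (GKS volume monotonicity
`Λ_n ⊆ Λ_L`), hence tend to `0`, and `φ_β(Λ_n) ≤ 2d tanh(β) a_n`. (The finite-volume core of
"`χ(β) < ∞ ⇒ β ≤ β̃_c`", Simon 1980 / Duminil-Copin–Tassion 2016, §2.1.) [cite: DuminilCopinTassionCMP2016, §2.1] [cite: Simon1980] -/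
theorem exists_dctIsingPhi_box_lt_one_of_bounded {β M : ℝ} (hβ : 0 ≤ β)
    (hM : ∀ L : ℕ, volumeSusceptibility (zdGraph d) (box d L) β 0 ≤ M) :
    ∃ n : ℕ, 1 ≤ n ∧ dctIsingPhi d β (box d n) < 1 := by
  set a : ℕ → ℝ := fun n => ∑ x ∈ sphere d n, isingTwoPoint (zdGraph d) (box d n) β 0 .free 0 x
    with ha
  have ha0 : ∀ n, 0 ≤ a n := fun n =>
    Finset.sum_nonneg fun x hx => isingTwoPoint_free_nonneg' hβ (zero_mem_box d n)
      (sphere_subset_box d n hx)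
  -- bounded partial sums
  have hpartial : ∀ N : ℕ, ∑ n ∈ Finset.range N, a n ≤ max M 0 := by
    intro N
    rcases N with _ | N
    · simp
    · calc ∑ n ∈ Finset.range (N + 1), a n
          ≤ ∑ n ∈ Finset.range (N + 1), ∑ x ∈ sphere d n,
              isingTwoPoint (zdGraph d) (box d N) β 0 .free 0 x := by
            refine Finset.sum_le_sum fun n hn => Finset.sum_le_sum fun x hx => ?_
            have hnN : n ≤ N := Nat.le_of_lt_succ (Finset.mem_range.1 hn)
            exact isingTwoPoint_free_mono_volume isingCorr_free_mono_volume_holds hβ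
              (box_mono d hnN) (zero_mem_box d n) (sphere_subset_box d n hx)
        _ = volumeSusceptibility (zdGraph d) (box d N) β 0 := by
            rw [volumeSusceptibility, sum_box_eq_sum_range_sum_sphere]
        _ ≤ max M 0 := (hM N).trans (le_max_left M 0)
  have hsum : Summable a := summable_of_sum_range_le ha0 hpartial
  have hto : Tendsto a atTop (𝓝 0) := hsum.tendsto_atTop_zero
  -- pick `n ≥ 1` with `(2d tanh β + 1) a_n < 1`
  set c : ℝ := 2 * d * Real.tanh β with hc
  have hc0 : 0 ≤ c := by simp only [hc]; exact mul_nonneg (by positivity) (tanh_nonneg hβ)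
  have hev : ∀ᶠ n in atTop, a n < 1 / (c + 1) :=
    hto.eventually_lt_const (one_div_pos.2 (by linarith))
  obtain ⟨n, hn, hn1⟩ := (hev.and (eventually_ge_atTop 1)).exists
  refine ⟨n, hn1, ?_⟩
  calc dctIsingPhi d β (box d n) ≤ c * a n := dctIsingPhi_box_le hβ n
    _ ≤ (c + 1) * a n := mul_le_mul_of_nonneg_right (by linarith) (ha0 n)
    _ < (c + 1) * (1 / (c + 1)) := mul_lt_mul_of_pos_left hn (by linarith)
    _ = 1 := by field_simp

/-- **`φ_β(S) < 1` is impossible for `β ≥ β_c` (`d ≥ 2`)**: by continuity of the finite-volume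
`φ` in `β` it would give `φ_{β'}(S) < 1` for some `β' > β_c`, hence `m*(β') = 0`
(`β̃_c ≤ β_c`, Duminil-Copin–Tassion 2016, §2.1, the tree theorem
`spontaneousMagnetization_eq_zero_of_mem_dctIsingSet_ghs`), contradicting `m*(β') > 0`
(Peierls; `spontaneousMagnetization_pos_of_criticalBeta_lt_holds`). [cite: DuminilCopinTassionCMP2016, §2.1 (β̃_c = β_c)] -/
theorem one_le_dctIsingPhi_of_criticalBeta_le (hd : 2 ≤ d) {β : ℝ} (hβ : criticalBeta d ≤ β)
    (S : Finset (Site d)) (h0 : (0 : Site d) ∈ S) : 1 ≤ dctIsingPhi d β S := by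
  by_contra hlt
  rw [not_le] at hlt
  have hβc : 0 < criticalBeta d := criticalBeta_pos_holds hd
  have hcont := (continuous_dctIsingPhi S).continuousAt (x := β)
  have hev : ∀ᶠ β' in 𝓝 β, dctIsingPhi d β' S < 1 := hcont.eventually_lt_const hlt
  have hev' : ∀ᶠ β' in 𝓝[>] β, dctIsingPhi d β' S < 1 ∧ β' ∈ Set.Ioi β :=
    (hev.filter_mono nhdsWithin_le_nhds).and eventually_mem_nhdsWithin
  obtain ⟨β', hφ, hββ'⟩ := hev'.exists
  rw [Set.mem_Ioi] at hββ'
  have hβ'c : criticalBeta d < β' := hβ.trans_lt hββ'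
  have hmem : β' ∈ dctIsingSet d := ⟨(hβc.trans hβ'c).le, S, h0, hφ⟩
  have hzero := spontaneousMagnetization_eq_zero_of_mem_dctIsingSet_ghs hmem
  have hpos := spontaneousMagnetization_pos_of_criticalBeta_lt_holds (d := d) (β := β') hd hβ'c
  exact hpos.ne' hzero

/-- **The susceptibility is unbounded below `β_c`** ("The susceptibility `χ_p` is known to
diverge as `p ↑ p_c` [a82, ag83]", Sakai 2007, §1.1): for the nearest-neighbour Ising model on
`ℤ^d`, `d ≥ 2`, `sup_{0 ≤ β < β_c} χ(β) = ∞`. Proof: if `χ ≤ M` on `[0, β_c)`, the box sums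
`∑_{y ∈ Λ_L} ⟨σ₀σ_y⟩_{Λ_L;β} ≤ M` pass to `β = β_c` by continuity in finite volume, and then
`φ_{β_c}(Λ_n) < 1` for some `n` (`exists_dctIsingPhi_box_lt_one_of_bounded`), which is
impossible (`one_le_dctIsingPhi_of_criticalBeta_le`). [cite: Sakai2007, §1.1] [cite: Aizenman1982, as cited by Sakai 2007 §1.1 ([a82])] [cite: DuminilCopinTassionCMP2016, §2.1] -/
theorem susceptibility_unbounded_below_criticalBeta (hd : 2 ≤ d) (M : ℝ) :
    ∃ β : ℝ, 0 ≤ β ∧ β < criticalBeta d ∧ ENNReal.ofReal M < susceptibility d β := by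
  by_contra H
  push Not at H
  set βc := criticalBeta d with hβc_def
  have hβc : 0 < βc := criticalBeta_pos_holds hd
  set M' := max M 0 with hM'
  have hM'0 : 0 ≤ M' := le_max_right M 0
  -- box sums bounded by `M'` on `[0, β_c)`
  have hbox : ∀ L : ℕ, ∀ β : ℝ, 0 ≤ β → β < βc →
      volumeSusceptibility (zdGraph d) (box d L) β 0 ≤ M' := fun L β hβ hβlt =>
    volumeSusceptibility_box_le_of_susceptibility_le hβ hM'0
      ((H β hβ hβlt).trans (ENNReal.ofReal_le_ofReal (le_max_left M 0))) L
  -- hence at `β_c`, by continuity in finite volume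
  have hboxc : ∀ L : ℕ, volumeSusceptibility (zdGraph d) (box d L) βc 0 ≤ M' := by
    intro L
    have hcont := ((continuous_volumeSusceptibility (box d L) (0 : Site d)).continuousAt
      (x := βc)).continuousWithinAt (s := Set.Iio βc)
    refine le_of_tendsto hcont ?_
    filter_upwards [Ioo_mem_nhdsLT hβc] with β hβ
    exact hbox L β hβ.1.le hβ.2
  obtain ⟨n, -, hφ⟩ := exists_dctIsingPhi_box_lt_one_of_bounded (criticalBeta_nonneg d) hboxc
  exact absurd hφ (not_lt.2 (one_le_dctIsingPhi_of_criticalBeta_le hd le_rfl (box d n) (zero_mem_box d n)))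

/-- The susceptibility is nondecreasing in `β ≥ 0` (Griffiths, termwise). [cite: FriedliVelenik2017, Exercise 3.9 with Thm. 3.20] -/
theorem susceptibility_mono {β β' : ℝ} (hβ : 0 ≤ β) (hββ' : β ≤ β') :
    susceptibility d β ≤ susceptibility d β' :=
  ENNReal.tsum_le_tsum fun x => ENNReal.ofReal_le_ofReal
    (twoPointFree_mono_beta isingCorr_free_mono_beta_holds hasBoxLimit_isingCorr_free_holds hβ hββ' x)

/-- **`χ(β) = ∞` for `β ≥ β_c`** (`d ≥ 2`): monotonicity in `β` and
`susceptibility_unbounded_below_criticalBeta` (Sakai 2007, §1.1: "`χ_p = ∞` if `p > p_c`";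
Aizenman–Barsky–Fernández 1987). This is the inclusion `{β ≥ 0 : χ(β) < ∞} ⊆ [0, β_c)` of the
named fact `Literature.Probability.LatticeModels.criticalBeta_eq_sSup_susceptibility_finite` (`Sharpness.lean`),
discharged below (`criticalBeta_eq_sSup_susceptibility_finite_holds`). [cite: Sakai2007, §1.1] [cite: AizenmanBarskyFernandezJSP1987, Thm. 1] -/
theorem susceptibility_eq_top_of_criticalBeta_le (hd : 2 ≤ d) {β : ℝ} (hβ : criticalBeta d ≤ β) :
    susceptibility d β = ⊤ := by
  by_contra hne
  set X : ℝ := (susceptibility d β).toReal with hX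
  have hXeq : susceptibility d β = ENNReal.ofReal X := (ENNReal.ofReal_toReal hne).symm
  obtain ⟨β', hβ'0, hβ'c, hlt⟩ := susceptibility_unbounded_below_criticalBeta hd (X + 1)
  have hle : susceptibility d β' ≤ susceptibility d β := susceptibility_mono hβ'0 (hβ'c.le.trans hβ)
  have h := hlt.trans_le hle
  rw [hXeq] at h
  have h' := (ENNReal.ofReal_lt_ofReal_iff'.1 h).1
  linarith

/-- **The mean-field bound `γ ≥ 1`** (Sakai 2007, §1.1: "These exponents (if they exist) are
known to obey the mean-field bounds: `β ≤ 1/2`, `γ ≥ 1` and `δ ≥ 3`"; Aizenman 1982; Glimm–Jaffe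
1987, §17): for the nearest-neighbour Ising model on `ℤ^d`, `d ≥ 2`, and `0 ≤ β < β_c`,
`χ(β) ≥ (4d (β_c - β))⁻¹`. (With the sharp Lebowitz inequality the constant is
`(2d(β_c-β))⁻¹ = (|J|(β_c-β))⁻¹`.) Proof: for `β < β₂ < β_c` and a large box,
`1/χ(β) ≤ 1/g_L(β) ≤ 4d(β₂ - β) + 1/g_L(β₂)` (`inv_supSusc_sub_inv_supSusc_le`,
`ofReal_volumeSusceptibility_le_susceptibility`) and `g_L(β₂) ≥ S_0^{Λ_L}(β₂)` is as large as
desired (`susceptibility_unbounded_below_criticalBeta`, `eventually_lt_volumeSusceptibility_box`). [cite: Sakai2007, §1.1] [cite: Aizenman1982, as cited by Sakai 2007 §1.1 ([a82])] [cite: GlimmJaffe1987, Cor. 4.3.3 and §17] -/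
theorem susceptibility_meanField_lower_bound (hd : 2 ≤ d) {β : ℝ} (hβ : 0 ≤ β)
    (hβc : β < criticalBeta d) :
    ENNReal.ofReal ((4 * d * (criticalBeta d - β))⁻¹) ≤ susceptibility d β := by
  classical
  set βc := criticalBeta d with hβc_def
  by_cases htop : susceptibility d β = ⊤
  · rw [htop]; exact le_top
  set X : ℝ := (susceptibility d β).toReal with hX
  have hXeq : susceptibility d β = ENNReal.ofReal X := (ENNReal.ofReal_toReal htop).symm
  have hX0 : 0 ≤ X := ENNReal.toReal_nonneg
  have hX1 : 1 ≤ X := by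
    have h1 : ENNReal.ofReal 1 ≤ susceptibility d β := by
      have := ofReal_volumeSusceptibility_le_susceptibility (d := d) hβ (zero_mem_box d 0)
      exact (ENNReal.ofReal_le_ofReal (one_le_volumeSusceptibility hβ (zero_mem_box d 0))).trans this
    rw [hXeq, ENNReal.ofReal_le_ofReal_iff hX0] at h1
    exact h1
  have hXpos : 0 < X := by linarith
  have hd0 : (0 : ℝ) < 4 * d := by
    have : (2 : ℝ) ≤ d := by exact_mod_cast hd
    linarith
  -- the key estimate: `1/X ≤ 4d(β_c - β) + ε` for every `ε > 0`
  have key : ∀ ε : ℝ, 0 < ε → X⁻¹ ≤ 4 * d * (βc - β) + ε := by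
    intro ε hε
    obtain ⟨β₂, hβ₂0, hβ₂c, hbig⟩ := susceptibility_unbounded_below_criticalBeta hd (2 / ε)
    rcases le_or_gt β₂ β with h21 | h12
    · -- `χ(β) ≥ χ(β₂) > 2/ε`, so `1/X < ε`
      have h := hbig.trans_le (susceptibility_mono hβ₂0 h21)
      rw [hXeq, ENNReal.ofReal_lt_ofReal_iff'] at h
      have hX2 : 2 / ε < X := h.1
      have h1 : X⁻¹ < ε := by
        rw [inv_lt_comm₀ hXpos hε]
        calc ε⁻¹ = 1 / ε := (one_div ε).symm
          _ < 2 / ε := by rw [div_lt_div_iff_of_pos_right hε]; norm_num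
          _ < X := hX2
      have h2 : 0 ≤ 4 * d * (βc - β) := mul_nonneg hd0.le (by linarith)
      linarith
    · -- a large box where `S_0(β₂) > 1/ε`
      have hr : ENNReal.ofReal (1 / ε) < susceptibility d β₂ :=
        lt_of_le_of_lt (ENNReal.ofReal_le_ofReal (by
          rw [div_le_div_iff_of_pos_right hε]; norm_num)) hbig
      obtain ⟨L, hL⟩ := (eventually_lt_volumeSusceptibility_box hβ₂0 hr).exists
      rw [ENNReal.ofReal_lt_ofReal_iff'] at hL
      have hS0 : 1 / ε < volumeSusceptibility (zdGraph d) (box d L) β₂ 0 := hL.1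
      set g : ℝ → ℝ := fun t => (box d L).sup' ⟨0, zero_mem_box d L⟩
        (fun v => volumeSusceptibility (zdGraph d) (box d L) t v) with hg
      have hstep : (g β)⁻¹ - (g β₂)⁻¹ ≤ 4 * d * (β₂ - β) :=
        inv_supSusc_sub_inv_supSusc_le (box d L) (zero_mem_box d L) hβ h12.le
      -- `g β ≤ X`
      have hgX : g β ≤ X := by
        obtain ⟨v, hv, hgv⟩ := Finset.exists_mem_eq_sup' ⟨(0 : Site d), zero_mem_box d L⟩
          (fun v => volumeSusceptibility (zdGraph d) (box d L) β v)
        change g β = _ at hgv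
        rw [hgv]
        have h := ofReal_volumeSusceptibility_le_susceptibility (d := d) hβ hv
        rw [hXeq, ENNReal.ofReal_le_ofReal_iff hXpos.le] at h
        exact h
      have hgpos : 0 < g β := lt_of_lt_of_le zero_lt_one
        ((one_le_volumeSusceptibility hβ (zero_mem_box d L)).trans
          (Finset.le_sup' (fun v => volumeSusceptibility (zdGraph d) (box d L) β v) (zero_mem_box d L)))
      -- `g β₂ ≥ S_0(β₂) > 1/ε`
      have hg2 : 1 / ε < g β₂ := hS0.trans_le
        (Finset.le_sup' (fun v => volumeSusceptibility (zdGraph d) (box d L) β₂ v) (zero_mem_box d L))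
      have hg2pos : 0 < g β₂ := (one_div_pos.2 hε).trans hg2
      have hinv2 : (g β₂)⁻¹ < ε := by
        rw [inv_lt_comm₀ hg2pos hε, ← one_div]; exact hg2
      have hinvX : X⁻¹ ≤ (g β)⁻¹ := inv_anti₀ hgpos hgX
      have h4 : 4 * d * (β₂ - β) ≤ 4 * d * (βc - β) :=
        mul_le_mul_of_nonneg_left (by linarith) hd0.le
      linarith
  have hinv : X⁻¹ ≤ 4 * d * (βc - β) := le_of_forall_pos_lt_add fun ε hε => by
    have := key (ε / 2) (half_pos hε); linarith
  have hprod : 0 < 4 * d * (βc - β) := mul_pos hd0 (by linarith)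
  rw [hXeq]
  refine ENNReal.ofReal_le_ofReal ?_
  rw [inv_le_comm₀ hprod hXpos]
  exact hinv

/-- **`χ(β) → ∞` as `β ↑ β_c`** (`d ≥ 2`), from the mean-field lower bound. [cite: Sakai2007, §1.1] -/
theorem tendsto_susceptibility_nhdsLT_criticalBeta (hd : 2 ≤ d) :
    Tendsto (susceptibility d) (𝓝[<] criticalBeta d) (𝓝 ⊤) := by
  have hβc : 0 < criticalBeta d := criticalBeta_pos_holds hd
  rw [ENNReal.tendsto_nhds_top_iff_nnreal]
  intro M
  have hd0 : (0 : ℝ) < 4 * d := by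
    have : (2 : ℝ) ≤ d := by exact_mod_cast hd
    linarith
  -- for `β_c - β < η := (4d (M+1))⁻¹` the lower bound exceeds `M`
  set η : ℝ := (4 * d * ((M : ℝ) + 1))⁻¹ with hη
  have hM1 : (0 : ℝ) < (M : ℝ) + 1 := by positivity
  have hη0 : 0 < η := by positivity
  have hmem : Set.Ioo (max 0 (criticalBeta d - η)) (criticalBeta d) ∈ 𝓝[<] criticalBeta d :=
    Ioo_mem_nhdsLT (max_lt hβc (by linarith))
  filter_upwards [hmem] with β hβ
  have hβ0 : 0 ≤ β := (le_max_left _ _).trans hβ.1.le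
  have hβη : criticalBeta d - η < β := (le_max_right _ _).trans_lt hβ.1
  refine lt_of_lt_of_le ?_ (susceptibility_meanField_lower_bound hd hβ0 hβ.2)
  have hpos : 0 < 4 * d * (criticalBeta d - β) := mul_pos hd0 (by linarith [hβ.2])
  have hlt : 4 * d * (criticalBeta d - β) < 4 * d * η := mul_lt_mul_of_pos_left (by linarith) hd0
  have hinv : (4 * d * η)⁻¹ < (4 * d * (criticalBeta d - β))⁻¹ := inv_strictAnti₀ hpos hlt
  have h4dη : (4 * d * η)⁻¹ = (M : ℝ) + 1 := by
    simp only [hη]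
    field_simp
  rw [h4dη] at hinv
  rw [← ENNReal.ofReal_coe_nnreal, ENNReal.ofReal_lt_ofReal_iff']
  exact ⟨by linarith, by positivity⟩

/-! ### `χ(β) < ∞` below `β_c` and the discharge of `criticalBeta_eq_sSup_susceptibility_finite` -/

/-- **Exponential decay is summable on `ℤ^d`**: `∑_{y ∈ Λ_L} e^{-c‖y‖} ≤ ∑_n (2n+1)^d e^{-cn} < ∞`
uniformly in `L` (shell decomposition `‖y‖_∞ = n`, `|∂Λ_n| ≤ |Λ_n| = (2n+1)^d`). [folklore] -/
theorem sum_box_exp_neg_mul_norm_le {c : ℝ} (hc : 0 < c) :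
    ∃ B : ℝ, ∀ L : ℕ, ∑ y ∈ box d L, Real.exp (-c * ‖y‖) ≤ B := by
  set r : ℝ := Real.exp (-c) with hr
  have hr0 : 0 < r := Real.exp_pos _
  have hr1 : r < 1 := Real.exp_lt_one_iff.2 (by linarith)
  have hrn : ‖r‖ < 1 := by rwa [Real.norm_eq_abs, abs_of_pos hr0]
  -- the majorant `n ↦ (2n+1)^d r^n` is summable: `(2n+1)^d ≤ 3^d (n^d + 1)`
  set F : ℕ → ℝ := fun n => (2 * n + 1 : ℝ) ^ d * r ^ n with hF
  have hF0 : ∀ n, 0 ≤ F n := fun n => by positivity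
  have hmaj : ∀ n : ℕ, F n ≤ (3 : ℝ) ^ d * ((n : ℝ) ^ d * r ^ n) + (3 : ℝ) ^ d * r ^ n := by
    intro n
    have hle : (2 * n + 1 : ℝ) ^ d ≤ (3 : ℝ) ^ d * ((n : ℝ) ^ d + 1) := by
      rcases Nat.eq_zero_or_pos n with rfl | hn
      · simp only [Nat.cast_zero, mul_zero, zero_add, one_pow]
        have h3 : (1 : ℝ) ≤ 3 ^ d := one_le_pow₀ (by norm_num)
        have h0 : (0 : ℝ) ≤ (0 : ℝ) ^ d := pow_nonneg le_rfl d
        nlinarith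
      · have hn1 : (1 : ℝ) ≤ n := by exact_mod_cast hn
        calc (2 * n + 1 : ℝ) ^ d ≤ (3 * n : ℝ) ^ d := pow_le_pow_left₀ (by positivity) (by linarith) d
          _ = (3 : ℝ) ^ d * (n : ℝ) ^ d := mul_pow _ _ _
          _ ≤ (3 : ℝ) ^ d * ((n : ℝ) ^ d + 1) := by
              refine mul_le_mul_of_nonneg_left (by linarith) (by positivity)
    calc F n = (2 * n + 1 : ℝ) ^ d * r ^ n := rfl
      _ ≤ (3 : ℝ) ^ d * ((n : ℝ) ^ d + 1) * r ^ n := mul_le_mul_of_nonneg_right hle (pow_nonneg hr0.le n)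
      _ = (3 : ℝ) ^ d * ((n : ℝ) ^ d * r ^ n) + (3 : ℝ) ^ d * r ^ n := by ring
  have hsumm : Summable F := by
    refine Summable.of_nonneg_of_le hF0 hmaj ?_
    exact ((summable_pow_mul_geometric_of_norm_lt_one d hrn).mul_left _).add
      ((summable_geometric_of_lt_one hr0.le hr1).mul_left _)
  refine ⟨∑' n, F n, fun L => ?_⟩
  -- shell decomposition
  have hshell : ∀ n : ℕ, ∑ y ∈ sphere d n, Real.exp (-c * ‖y‖) ≤ F n := by
    intro n
    have hterm : ∀ y ∈ sphere d n, Real.exp (-c * ‖y‖) = r ^ n := by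
      intro y hy
      rw [Site.norm_eq_supNorm, mem_sphere.1 hy, hr, ← Real.exp_nat_mul]
      congr 1; ring
    rw [Finset.sum_congr rfl hterm, Finset.sum_const, nsmul_eq_mul]
    refine mul_le_mul_of_nonneg_right ?_ (pow_nonneg hr0.le n)
    have h1 : #(sphere d n) ≤ (2 * n + 1) ^ d := by
      rw [← card_box d n]; exact Finset.card_le_card (sphere_subset_box d n)
    exact_mod_cast h1
  calc ∑ y ∈ box d L, Real.exp (-c * ‖y‖)
      = ∑ n ∈ Finset.range (L + 1), ∑ y ∈ sphere d n, Real.exp (-c * ‖y‖) :=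
        sum_box_eq_sum_range_sum_sphere L _
    _ ≤ ∑ n ∈ Finset.range (L + 1), F n := Finset.sum_le_sum fun n _ => hshell n
    _ ≤ ∑' n, F n := hsumm.sum_le_tsum _ fun n _ => hF0 n

/-- **`χ(β) < ∞` for `0 ≤ β < β_c`** (`d ≥ 2`): the free two-point function decays exponentially
below `β_c` (Aizenman–Barsky–Fernández 1987, Thm. 1; Duminil-Copin–Tassion 2016, Thm. 1.2 — the
tree theorem `twoPoint_exponentialDecay_of_lt_criticalBeta_holds`), and exponential decay is
summable (`sum_box_exp_neg_mul_norm_le`). [cite: AizenmanBarskyFernandezJSP1987, Thm. 1] [cite: DuminilCopinTassionCMP2016, Thm. 1.2] -/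
theorem susceptibility_lt_top_of_lt_criticalBeta (hd : 2 ≤ d) {β : ℝ} (hβ : 0 ≤ β)
    (hβc : β < criticalBeta d) : susceptibility d β < ⊤ := by
  obtain ⟨c, hc, hdec⟩ := twoPoint_exponentialDecay_of_lt_criticalBeta_holds (d := d) hd hβ hβc
  obtain ⟨B, hB⟩ := sum_box_exp_neg_mul_norm_le (d := d) hc
  have hlim : hasBoxLimit_isingCorr_free d := hasBoxLimit_isingCorr_free_holds
  have hgks : ∀ {Λ A : Finset (Site d)} {β h : ℝ} {bc : BoundaryCondition (Site d)},
      gks_one (zdGraph d) (Λ := Λ) (A := A) (β := β) (h := h) (bc := bc) :=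
    Literature.Probability.LatticeModels.GKSInequalities.gks_one_holds (zdGraph d)
  have hG0 : ∀ y, 0 ≤ twoPointFree d β y := fun y => twoPointFree_nonneg hlim hgks hβ y
  refine lt_of_le_of_lt ?_ (ENNReal.ofReal_lt_top (r := B))
  rw [susceptibility_eq_iSup_box_sum]
  refine iSup_le fun L => ?_
  rw [← ENNReal.ofReal_sum_of_nonneg fun y _ => hG0 y]
  exact ENNReal.ofReal_le_ofReal ((Finset.sum_le_sum fun y _ => hdec y).trans (hB L))

/-- **Discharge of `criticalBeta_eq_sSup_susceptibility_finite`** (crit-ising.S08, the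
susceptibility characterisation of `β_c`: Aizenman–Barsky–Fernández 1987, Thm. 1 and Cor.;
Duminil-Copin–Tassion 2016, Thm. 1.2; Friedli–Velenik 2017, §3.7.4): for `d ≥ 2`,
`β_c = sup{β ≥ 0 : χ(β) < ∞}`. Indeed `{β ≥ 0 : χ(β) < ∞} = [0, β_c)` by
`susceptibility_lt_top_of_lt_criticalBeta` and `susceptibility_eq_top_of_criticalBeta_le`, and
`β_c > 0`. [cite: FriedliVelenik2017, §3.7.4] [cite: AizenmanBarskyFernandezJSP1987, Thm. 1] [cite: DuminilCopinTassionCMP2016, Thm. 1.2] -/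
theorem criticalBeta_eq_sSup_susceptibility_finite_holds :
    criticalBeta_eq_sSup_susceptibility_finite (d := d) := by
  intro hd
  have hβc : 0 < criticalBeta d := criticalBeta_pos_holds hd
  set S : Set ℝ := {β : ℝ | 0 ≤ β ∧ susceptibility d β < ⊤} with hS
  have hSsub : ∀ β ∈ S, β < criticalBeta d := by
    rintro β ⟨-, hχ⟩
    by_contra h
    exact hχ.ne (susceptibility_eq_top_of_criticalBeta_le hd (not_lt.1 h))
  have hSmem : ∀ β, 0 ≤ β → β < criticalBeta d → β ∈ S := fun β hβ hβc' =>
    ⟨hβ, susceptibility_lt_top_of_lt_criticalBeta hd hβ hβc'⟩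
  have hne : S.Nonempty := ⟨0, hSmem 0 le_rfl hβc⟩
  have hbdd : BddAbove S := ⟨criticalBeta d, fun β hβ => (hSsub β hβ).le⟩
  refine le_antisymm ?_ (csSup_le hne fun β hβ => (hSsub β hβ).le)
  refine le_of_forall_lt_imp_le_of_dense fun β hβ => ?_
  rcases lt_or_ge β 0 with hneg | hβ0
  · exact hneg.le.trans (le_csSup hbdd (hSmem 0 le_rfl hβc))
  · exact le_csSup hbdd (hSmem β hβ0 hβ)

end Literature.Probability.LatticeModels
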